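import Mathlib.Data.Finset.Card
import Mathlib.Data.Finset.Powerset
import Mathlib.Data.Finset.Max
import Mathlib.Data.Fintype.Powerset
import Mathlib.Data.Fin.VecNotation
import Mathlib.Data.Fin.Tuple.Basic
import Mathlib.Data.Nat.Choose.Sum
import Mathlib.Data.Nat.Choose.Bounds
import Mathlib.Algebra.BigOperators.Group.Finset.Basic
import Mathlib.Algebra.Group.Action.Defs
import Mathlib.Algebra.Order.BigOperators.Group.Finset
import Mathlib.Tactic.FinCases
import Mathlib.Tactic.Ring
import Mathlib.Tactic.Positivity
import HarnessLib

/-!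
# Razborov's closed families of vertex sets (Alon–Boppana 1987, §3.1–3.2)

The combinatorial core of Razborov's approximation method for the clique function in the
form of Alon and Boppana (*The monotone circuit complexity of Boolean functions*,
Combinatorica 7 (1987), §3.1–3.2), used for the monotone lower bound `razborov_alon_boppana`
(pnp.S22, `CircuitLowerBounds.lean`). Everything in this file is PROVED.

* `Razborov.Implies r A U` — the sets `W₁, …, W_r ∈ A` *imply* `U` (`W_i ∩ W_j ⊆ U` for all
  `i ≠ j`; Alon–Boppana §3.1, "`W₁, …, W_r ⊢ W`").
* `Razborov.HasPropP r k F` — property `P(r, k)` (Alon–Boppana §3.2): all members have at most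
  `k` elements and no member `W` has a proper subset `U ⊂ W` implied by `r` members of `F`.
* `Razborov.HasPropP.card_le` — the upper-bound half of **Lemma 3.2** of Alon–Boppana
  (`h(r, k) = (r - 1) ^ k`; the product construction showing tightness is not needed here and
  not formalised): a family with property `P(r, k)`, `r ≥ 2`, has at most `(r - 1) ^ k`
  members (induction on `r`, splitting the family according to the trace `W ∩ D` on a fixed
  member `D`).
* `Razborov.smallSets α l` — the universe `𝒱(l)` of vertex sets of size `≤ l`, with the
  Alon–Boppana convention (§3.1: a closed family with a member of cardinality `1` contains `∅`)
  built in by excluding singletons and sending an implied set of size `≤ 1` to `∅` (`canon`);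
  `Razborov.IsClosedFamily r l A` — closed subfamilies of `𝒱(l)`; `Razborov.closure` — the
  closure `A*` (intersection of all closed families containing `A`), with `subset_closure`,
  `isClosedFamily_closure`, `closure_subset_of_isClosedFamily`, `closure_eq_of_isClosedFamily`
  (for `A ⊄ 𝒱(l)` the closure is the junk value `𝒱(l)`, `closure_eq_smallSets_of_not_subset`).
* `Razborov.minimals` (the inclusion-minimal members of a family of finsets, via Mathlib's
  `Minimal`; the same notion as `Literature.Computability.FineGrained.Sparsification.minimals` of
  `Literature/Computability/FineGrained/Sparsification.lean`, kept local because that file's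
  import closure is all of `Mathlib` — a candidate for a librarian hoist into a shared `Finset`
  helper), `IsClosedFamily.card_minimals_filter_le` — **Corollary 3.3** of Alon–Boppana: a
  closed family has at most `(r - 1) ^ k` minimal members of cardinality `≤ k`.
* `Razborov.card_smallSets_le` — `|𝒱(l)| ≤ (|V| + 1) ^ l` (the crude bound on the number of
  closure steps, Alon–Boppana §3.2, remark before Lemma 3.4).

## References

* N. Alon, R. B. Boppana, *The monotone circuit complexity of Boolean functions*,
  Combinatorica 7 (1987) 1–22, §3.1 (the lattice `K(m, r, l)`), Lemma 3.2, Corollary 3.3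
  [AlonBoppana1987].
* A. A. Razborov, *Lower bounds on the monotone complexity of some Boolean functions*, Dokl.
  Akad. Nauk SSSR 281 (1985) 798–801 [Razborov1985].
-/

namespace Literature.Computability.Complexity

namespace Razborov

open Finset

variable {α : Type*} [DecidableEq α]

/-! ### Implication and property `P(r, k)` -/

/-- `Implies r A U`: there are (not necessarily distinct) `W₁, …, W_r ∈ A` that *imply* `U`,
i.e. `W_i ∩ W_j ⊆ U` for all `i ≠ j` (Alon–Boppana 1987, §3.1, `W₁, …, W_r ⊢ W` and
`A ⊢ W`; the cardinality constraints live in `IsClosedFamily`). [cite: AlonBoppana1987, §3.1] -/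
def Implies (r : ℕ) (A : Finset (Finset α)) (U : Finset α) : Prop :=
  ∃ W : Fin r → Finset α, (∀ i, W i ∈ A) ∧ ∀ i j, i ≠ j → W i ∩ W j ⊆ U

/-- Implication is monotone in the family. [folklore] -/
theorem Implies.mono {r : ℕ} {A B : Finset (Finset α)} {U : Finset α} (h : Implies r A U)
    (hAB : A ⊆ B) : Implies r B U := by
  obtain ⟨W, hW, hWU⟩ := h
  exact ⟨W, fun i => hAB (hW i), hWU⟩

/-- Implication is monotone in the implied set. [folklore] -/
theorem Implies.of_subset {r : ℕ} {A : Finset (Finset α)} {U U' : Finset α} (h : Implies r A U)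
    (hU : U ⊆ U') : Implies r A U' := by
  obtain ⟨W, hW, hWU⟩ := h
  exact ⟨W, hW, fun i j hij => (hWU i j hij).trans hU⟩

/-- `r` copies of a member `W ⊆ U` imply `U` (Alon–Boppana 1987, §3.1: "if `W₁ ⊆ W` then `r`
copies of `W₁` imply `W`"). [cite: AlonBoppana1987, §3.1] -/
theorem implies_of_mem_of_subset {r : ℕ} {A : Finset (Finset α)} {W U : Finset α} (hW : W ∈ A)
    (hWU : W ⊆ U) : Implies r A U :=
  ⟨fun _ => W, fun _ => hW, fun _ _ _ => by rwa [inter_self]⟩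

/-- Property `P(r, k)` of a family `F` (Alon–Boppana 1987, §3.2): every member has at most `k`
elements, and there are no `W, W₁, …, W_r ∈ F` and `U ⊂ W` (proper) with `W_i ∩ W_j ⊆ U` for all
`i ≠ j`. [cite: AlonBoppana1987, §3.2] -/
def HasPropP (r k : ℕ) (F : Finset (Finset α)) : Prop :=
  (∀ W ∈ F, #W ≤ k) ∧ ∀ W ∈ F, ∀ U, U ⊂ W → ¬ Implies r F U

/-- Property `P` is inherited by subfamilies. [folklore] -/
theorem HasPropP.anti {r k : ℕ} {F G : Finset (Finset α)} (h : HasPropP r k G) (hFG : F ⊆ G) :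
    HasPropP r k F :=
  ⟨fun W hW => h.1 W (hFG hW), fun W hW U hU hI => h.2 W (hFG hW) U hU (hI.mono hFG)⟩

/-- The *trace family* `F_C = {W ∖ C : W ∈ F, W ∩ D = C}` of the proof of Alon–Boppana's
Lemma 3.2. [cite: AlonBoppana1987, Lemma 3.2] -/
def traceFamily (F : Finset (Finset α)) (D C : Finset α) : Finset (Finset α) :=
  (F.filter fun W => W ∩ D = C).image fun W => W \ C

/-- `W ↦ W ∖ C` is injective on `{W ∈ F : W ∩ D = C}`, so the trace family has as many members.
[cite: AlonBoppana1987, Lemma 3.2] -/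
theorem card_filter_inter_eq (F : Finset (Finset α)) (D C : Finset α) :
    #(F.filter fun W => W ∩ D = C) = #(traceFamily F D C) := by
  rw [traceFamily, card_image_of_injOn]
  intro W hW W' hW' h
  simp only [coe_filter, Set.mem_setOf_eq] at hW hW'
  have hCW : C ⊆ W := hW.2 ▸ inter_subset_left
  have hCW' : C ⊆ W' := hW'.2 ▸ inter_subset_left
  dsimp only at h
  calc W = (W \ C) ∪ C := (sdiff_union_of_subset hCW).symm
    _ = (W' \ C) ∪ C := by rw [h]
    _ = W' := sdiff_union_of_subset hCW'

/-- The trace family of a family with property `P(r + 1, k)` on a member `D` and `C ⊆ D` has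
property `P(r, k - |C|)` (Alon–Boppana 1987, proof of Lemma 3.2: a violation
`W', W'₁, …, W'ᵣ, U'` lifts to the violation `W' ∪ C, W'₁ ∪ C, …, W'ᵣ ∪ C, D, U' ∪ C`).
[cite: AlonBoppana1987, Lemma 3.2] -/
theorem HasPropP.traceFamily {r k : ℕ} {F : Finset (Finset α)} (hF : HasPropP (r + 1) k F)
    {D : Finset α} (hD : D ∈ F) (C : Finset α) :
    HasPropP r (k - #C) (traceFamily F D C) := by
  refine ⟨fun W' hW' => ?_, fun W' hW' U' hU' hImp => ?_⟩
  · obtain ⟨W, hW, rfl⟩ := mem_image.1 hW'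
    obtain ⟨hWF, hWD⟩ := mem_filter.1 hW
    have hCW : C ⊆ W := hWD ▸ inter_subset_left
    rw [card_sdiff_of_subset hCW]
    exact Nat.sub_le_sub_right (hF.1 W hWF) _
  · obtain ⟨W₀, hW₀, rfl⟩ := mem_image.1 hW'
    obtain ⟨hW₀F, hW₀D⟩ := mem_filter.1 hW₀
    have hCW₀ : C ⊆ W₀ := hW₀D ▸ inter_subset_left
    obtain ⟨Ws', hWs'mem, hWs'⟩ := hImp
    have hpre : ∀ i, ∃ V ∈ F, V ∩ D = C ∧ Ws' i = V \ C := fun i => by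
      obtain ⟨V, hV, hVeq⟩ := mem_image.1 (hWs'mem i)
      exact ⟨V, (mem_filter.1 hV).1, (mem_filter.1 hV).2, hVeq.symm⟩
    choose V hVF hVD hVeq using hpre
    have hU'sub : U' ⊆ W₀ \ C := hU'.1
    refine hF.2 W₀ hW₀F (U' ∪ C) ⟨?_, fun hsub => hU'.2 fun x hx => ?_⟩ ⟨Fin.cons D V, ?_, ?_⟩
    · exact union_subset (hU'sub.trans sdiff_subset) hCW₀
    · have hx' : x ∈ U' ∪ C := hsub (mem_sdiff.1 hx).1
      rcases mem_union.1 hx' with h | h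
      · exact h
      · exact absurd h (mem_sdiff.1 hx).2
    · intro i
      refine Fin.cases ?_ (fun j => ?_) i
      · simpa using hD
      · simpa using hVF j
    · intro i j hij
      refine Fin.cases ?_ (fun i' => ?_) i j hij
      · intro j h0j
        refine Fin.cases (fun h => absurd rfl h) (fun j' _ => ?_) j h0j
        simp only [Fin.cons_zero, Fin.cons_succ]
        rw [inter_comm, hVD j']
        exact subset_union_right
      · intro j hij
        refine Fin.cases (fun _ => ?_) (fun j' hij' => ?_) j hij
        · simp only [Fin.cons_zero, Fin.cons_succ]
          rw [hVD i']
          exact subset_union_right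
        · simp only [Fin.cons_succ]
          have hne : i' ≠ j' := fun h => hij' (by rw [h])
          intro x hx
          rw [mem_inter] at hx
          by_cases hxC : x ∈ C
          · exact mem_union_right _ hxC
          · refine mem_union_left _ (hWs' i' j' hne ?_)
            rw [hVeq i', hVeq j', mem_inter, mem_sdiff, mem_sdiff]
            exact ⟨⟨hx.1, hxC⟩, hx.2, hxC⟩

/-- **Alon–Boppana, Lemma 3.2** (`h(r, k) ≤ (r-1)^k`), inductive form: a family with property
`P(n + 2, k)` has at most `(n + 1) ^ k` members. (`r = 2`: two distinct members `W₁, W₂`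
violate `P` with `U = W₁ ∩ W₂`; step: `|F| = Σ_{C ⊆ D} |F_C| ≤ Σ_i (|D| choose i) (r-2)^(k-i)
≤ (r-1)^k`.) [cite: AlonBoppana1987, Lemma 3.2] -/
theorem card_le_pow_of_hasPropP :
    ∀ (n k : ℕ) (F : Finset (Finset α)), HasPropP (n + 2) k F → #F ≤ (n + 1) ^ k := by
  intro n
  induction n with
  | zero =>
    intro k F hF
    rw [zero_add, one_pow]
    by_contra h
    push Not at h
    obtain ⟨W₁, hW₁, W₂, hW₂, hne⟩ := one_lt_card.1 h
    have key : ∀ {A B : Finset α}, A ∈ F → B ∈ F → ¬ (A ⊆ B) → False := by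
      intro A B hA hB hAB
      refine hF.2 A hA (A ∩ B) ⟨inter_subset_left, fun h' => hAB fun x hx => ?_⟩
        ⟨![A, B], fun i => ?_, fun i j hij => ?_⟩
      · exact (mem_inter.1 (h' hx)).2
      · fin_cases i
        · simpa using hA
        · simpa using hB
      · fin_cases i <;> fin_cases j
        · exact absurd rfl hij
        · simp
        · simp [inter_comm]
        · exact absurd rfl hij
    by_cases h12 : W₁ ⊆ W₂
    · exact key hW₂ hW₁ fun h21 => hne (Subset.antisymm h12 h21)
    · exact key hW₁ hW₂ h12
  | succ n ih =>
    intro k F hF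
    rcases F.eq_empty_or_nonempty with rfl | ⟨D, hD⟩
    · simp
    have hDk : #D ≤ k := hF.1 D hD
    calc #F = ∑ C ∈ D.powerset, #(F.filter fun W => W ∩ D = C) :=
          card_eq_sum_card_fiberwise fun W _ => by
            simp only [mem_coe, mem_powerset]
            exact inter_subset_right
      _ = ∑ C ∈ D.powerset, #(traceFamily F D C) := by
          refine sum_congr rfl fun C _ => ?_
          exact card_filter_inter_eq F D C
      _ ≤ ∑ C ∈ D.powerset, (n + 1) ^ (k - #C) :=
          sum_le_sum fun C _ => ih (k - #C) _ (hF.traceFamily hD C)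
      _ = ∑ i ∈ range (#D + 1), (#D).choose i * (n + 1) ^ (k - i) := by
          rw [sum_powerset_apply_card (fun j => (n + 1) ^ (k - j))]
          simp only [smul_eq_mul]
      _ ≤ ∑ i ∈ range (#D + 1), k.choose i * (n + 1) ^ (k - i) :=
          sum_le_sum fun i _ => Nat.mul_le_mul_right _ (Nat.choose_le_choose i hDk)
      _ ≤ ∑ i ∈ range (k + 1), k.choose i * (n + 1) ^ (k - i) :=
          sum_le_sum_of_subset (range_subset_range.2 (by omega))
      _ = (n + 1 + 1) ^ k := by
          rw [show n + 1 + 1 = 1 + (n + 1) by ring, add_pow]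
          refine sum_congr rfl fun i _ => ?_
          rw [one_pow, one_mul, mul_comm, Nat.cast_id]

/-- **Alon–Boppana, Lemma 3.2** (upper-bound half of `h(r, k) = (r - 1)^k`; the matching
construction is not formalised): a family with property `P(r, k)`, `r ≥ 2`, has at most
`(r - 1) ^ k` members. [cite: AlonBoppana1987, Lemma 3.2] -/
theorem HasPropP.card_le {r k : ℕ} (hr : 2 ≤ r) {F : Finset (Finset α)} (hF : HasPropP r k F) :
    #F ≤ (r - 1) ^ k := by
  obtain ⟨n, rfl⟩ : ∃ n, r = n + 2 := ⟨r - 2, by omega⟩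
  have h := card_le_pow_of_hasPropP n k F hF
  simpa using h

/-! ### Minimal members of a family of finsets -/

open Classical in
/-- The minimal members (w.r.t. inclusion) of a family of finsets, i.e. the members `W` with
`Minimal (· ∈ F) W` (Mathlib's order-theoretic minimality). The same notion as
`Literature.Computability.FineGrained.Sparsification.minimals` (`Literature/Computability/FineGrained/Sparsification.lean`,
with the same three API lemmas below); kept local because importing that file would pull in all
of `Mathlib` — both copies are candidates for a librarian hoist into a shared `Finset` helper.
[folklore] -/
noncomputable def minimals (F : Finset (Finset α)) : Finset (Finset α) :=
  F.filter fun W => Minimal (· ∈ F) W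

omit [DecidableEq α] in
/-- Minimal members are members. [folklore] -/
theorem minimals_subset (F : Finset (Finset α)) : minimals F ⊆ F := by
  classical
  exact filter_subset _ _

omit [DecidableEq α] in
/-- Membership in `minimals`: a member with no proper sub-member. [folklore] -/
theorem mem_minimals {F : Finset (Finset α)} {W : Finset α} :
    W ∈ minimals F ↔ W ∈ F ∧ ∀ W' ∈ F, W' ⊆ W → W' = W := by
  classical
  unfold minimals
  rw [mem_filter, Minimal]
  constructor
  · rintro ⟨hW, -, h⟩
    exact ⟨hW, fun W' hW' hsub => Subset.antisymm hsub (h hW' hsub)⟩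
  · rintro ⟨hW, h⟩
    exact ⟨hW, hW, fun W' hW' hsub => (h W' hW' hsub).symm.subset⟩

/-- Every member contains a minimal member (a member below it of least cardinality).
[folklore] -/
theorem exists_minimal_subset {F : Finset (Finset α)} {W : Finset α} (hW : W ∈ F) :
    ∃ M ∈ minimals F, M ⊆ W := by
  obtain ⟨M, hM, hmin⟩ := exists_min_image (F.filter fun W' => W' ⊆ W) card
    ⟨W, mem_filter.2 ⟨hW, Subset.rfl⟩⟩
  obtain ⟨hMF, hMW⟩ := mem_filter.1 hM
  refine ⟨M, mem_minimals.2 ⟨hMF, fun W' hW' hW'M => ?_⟩, hMW⟩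
  exact eq_of_subset_of_card_le hW'M (hmin W' (mem_filter.2 ⟨hW', hW'M.trans hMW⟩))

omit [DecidableEq α] in
/-- If `∅` belongs to the family, it is the only minimal member. [folklore] -/
theorem minimals_eq_singleton_empty_of_mem {F : Finset (Finset α)} (h : ∅ ∈ F) :
    minimals F = {∅} := by
  ext W
  rw [mem_minimals, mem_singleton]
  constructor
  · rintro ⟨-, hmin⟩
    exact (hmin ∅ h (empty_subset W)).symm
  · rintro rfl
    exact ⟨h, fun W' _ hW' => subset_empty.1 hW'⟩

/-! ### The universe `𝒱(l)`, closed families and the closure -/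

variable [Fintype α]

/-- The universe `𝒱(l)` of vertex sets of cardinality at most `l` (Alon–Boppana 1987, §3.1),
with singletons removed: a clique on at most one vertex is contained in every graph, and
Alon–Boppana's convention (§3.1) that a closed family with a member of cardinality `1` contains
`∅` is implemented by never using singletons (see `canon`). [cite: AlonBoppana1987, §3.1] -/
def smallSets (α : Type*) [DecidableEq α] [Fintype α] (l : ℕ) : Finset (Finset α) :=
  univ.filter fun W => #W ≤ l ∧ #W ≠ 1

/-- Membership in `𝒱(l)`. [folklore] -/
@[simp] theorem mem_smallSets {l : ℕ} {W : Finset α} : W ∈ smallSets α l ↔ #W ≤ l ∧ #W ≠ 1 := by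
  simp [smallSets]

/-- `∅ ∈ 𝒱(l)`. [folklore] -/
theorem empty_mem_smallSets (l : ℕ) : (∅ : Finset α) ∈ smallSets α l := by simp

/-- The canonical form of an implied set: sets of cardinality `≤ 1` are replaced by `∅`
(Alon–Boppana 1987, §3.1: "we agree that `A ⊢ ∅` if there is a set `W ∈ A` with `|W| = 1`").
[cite: AlonBoppana1987, §3.1] -/
def canon (U : Finset α) : Finset α := if #U ≤ 1 then ∅ else U

omit [DecidableEq α] [Fintype α] in
/-- `canon U ⊆ U`. [folklore] -/
theorem canon_subset (U : Finset α) : canon U ⊆ U := by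
  unfold canon; split_ifs
  · exact empty_subset _
  · exact Subset.rfl

/-- `canon U ∈ 𝒱(l)` when `|U| ≤ l`. [folklore] -/
theorem canon_mem_smallSets {l : ℕ} {U : Finset α} (hU : #U ≤ l) : canon U ∈ smallSets α l := by
  unfold canon; split_ifs with h
  · simp
  · rw [mem_smallSets]; omega

omit [DecidableEq α] [Fintype α] in
/-- `canon U = U` when `|U| ≥ 2`. [folklore] -/
theorem canon_eq_self {U : Finset α} (hU : 2 ≤ #U) : canon U = U := by
  unfold canon; rw [if_neg (by omega)]

omit [DecidableEq α] [Fintype α] in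
/-- `canon U = ∅` when `|U| ≤ 1`. [folklore] -/
theorem canon_eq_empty {U : Finset α} (hU : #U ≤ 1) : canon U = ∅ := by
  unfold canon; rw [if_pos hU]

/-- A *closed* family (Alon–Boppana 1987, §3.1): a subfamily `A ⊆ 𝒱(l)` containing (the
canonical form of) every set of cardinality `≤ l` implied by `r` of its members.
[cite: AlonBoppana1987, §3.1] -/
structure IsClosedFamily (r l : ℕ) (A : Finset (Finset α)) : Prop where
  /-- members are small vertex sets -/
  subset : A ⊆ smallSets α l
  /-- closed under implication -/
  mem_of_implies : ∀ U : Finset α, #U ≤ l → Implies r A U → canon U ∈ A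

/-- `𝒱(l)` itself is closed. [cite: AlonBoppana1987, §3.1] -/
theorem isClosedFamily_smallSets (r l : ℕ) : IsClosedFamily r l (smallSets α l) :=
  ⟨Subset.rfl, fun _ hU _ => canon_mem_smallSets hU⟩

/-- The intersection of closed families is closed (the meet of the lattice `K(m, r, l)`,
Alon–Boppana 1987, Lemma 3.1). [cite: AlonBoppana1987, Lemma 3.1] -/
theorem IsClosedFamily.inter {r l : ℕ} {A B : Finset (Finset α)} (hA : IsClosedFamily r l A)
    (hB : IsClosedFamily r l B) : IsClosedFamily r l (A ∩ B) :=
  ⟨inter_subset_left.trans hA.subset, fun U hU hI =>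
    mem_inter.2 ⟨hA.mem_of_implies U hU (hI.mono inter_subset_left),
      hB.mem_of_implies U hU (hI.mono inter_subset_right)⟩⟩

/-- Closed families are upward closed inside `𝒱(l)` (Alon–Boppana 1987, §3.1: `r` copies of
`W ⊆ W'` imply `W'`). [cite: AlonBoppana1987, §3.1] -/
theorem IsClosedFamily.mem_of_subset {r l : ℕ} {A : Finset (Finset α)} (hA : IsClosedFamily r l A)
    {W W' : Finset α} (hW : W ∈ A) (hWW' : W ⊆ W') (hW' : W' ∈ smallSets α l) : W' ∈ A := by
  rw [mem_smallSets] at hW'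
  have h := hA.mem_of_implies W' hW'.1 (implies_of_mem_of_subset hW hWW')
  by_cases h1 : #W' ≤ 1
  · have h0 : W' = ∅ := by rw [← card_eq_zero]; omega
    rw [canon_eq_empty h1] at h
    rwa [h0]
  · rwa [canon_eq_self (by omega)] at h

/-- A closed family containing `∅` is all of `𝒱(l)` (so its clique approximator is the
constant `1`). [cite: AlonBoppana1987, §3.1] -/
theorem IsClosedFamily.eq_smallSets_of_empty_mem {r l : ℕ} {A : Finset (Finset α)}
    (hA : IsClosedFamily r l A) (h : ∅ ∈ A) : A = smallSets α l :=
  Subset.antisymm hA.subset fun _ hW' => hA.mem_of_subset h (empty_subset _) hW'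

open Classical in
/-- The *closure* `A*` of a family `A ⊆ 𝒱(l)`: the intersection of all closed subfamilies of
`𝒱(l)` containing `A` (Alon–Boppana 1987, §3.1). **Junk value**: for `A ⊄ 𝒱(l)` there is no
such subfamily and the value is all of `𝒱(l)` (`closure_eq_smallSets_of_not_subset`).
[cite: AlonBoppana1987, §3.1] -/
noncomputable def closure (r l : ℕ) (A : Finset (Finset α)) : Finset (Finset α) :=
  (smallSets α l).filter fun W =>
    ∀ B ∈ (smallSets α l).powerset, A ⊆ B → IsClosedFamily r l B → W ∈ B

/-- `A* ⊆ 𝒱(l)`. [folklore] -/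
theorem closure_subset_smallSets (r l : ℕ) (A : Finset (Finset α)) :
    closure r l A ⊆ smallSets α l := by
  classical
  exact filter_subset _ _

/-- `A ⊆ A*` for `A ⊆ 𝒱(l)` (Alon–Boppana 1987, §3.1, closure relation). [cite: AlonBoppana1987, §3.1] -/
theorem subset_closure {r l : ℕ} {A : Finset (Finset α)} (hA : A ⊆ smallSets α l) :
    A ⊆ closure r l A := by
  classical
  intro W hW
  unfold closure
  rw [mem_filter]
  exact ⟨hA hW, fun B _ hAB _ => hAB hW⟩

/-- `A*` is contained in every closed family containing `A`. [cite: AlonBoppana1987, §3.1] -/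
theorem closure_subset_of_isClosedFamily {r l : ℕ} {A B : Finset (Finset α)} (hAB : A ⊆ B)
    (hB : IsClosedFamily r l B) : closure r l A ⊆ B := by
  classical
  intro W hW
  unfold closure at hW
  rw [mem_filter] at hW
  exact hW.2 B (mem_powerset.2 hB.subset) hAB hB

/-- `A*` is closed. [cite: AlonBoppana1987, §3.1] -/
theorem isClosedFamily_closure (r l : ℕ) (A : Finset (Finset α)) :
    IsClosedFamily r l (closure r l A) := by
  classical
  refine ⟨closure_subset_smallSets r l A, fun U hU hI => ?_⟩
  unfold closure
  rw [mem_filter]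
  refine ⟨canon_mem_smallSets hU, fun B hB hAB hBc => ?_⟩
  exact hBc.mem_of_implies U hU (hI.mono (closure_subset_of_isClosedFamily hAB hBc))

/-- The closure of a closed family is itself (`(A*)* = A*`). [cite: AlonBoppana1987, §3.1] -/
theorem closure_eq_of_isClosedFamily {r l : ℕ} {A : Finset (Finset α)} (hA : IsClosedFamily r l A) :
    closure r l A = A :=
  Subset.antisymm (closure_subset_of_isClosedFamily Subset.rfl hA) (subset_closure hA.subset)

/-- The junk value: a family not contained in `𝒱(l)` has closure `𝒱(l)`. [folklore] -/
theorem closure_eq_smallSets_of_not_subset {r l : ℕ} {A : Finset (Finset α)}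
    (hA : ¬ A ⊆ smallSets α l) : closure r l A = smallSets α l := by
  classical
  refine Subset.antisymm (closure_subset_smallSets r l A) fun W hW => ?_
  unfold closure
  rw [mem_filter]
  exact ⟨hW, fun B hB hAB _ => absurd (hAB.trans (mem_powerset.1 hB)) hA⟩

/-- The closure is monotone (`A ⊆ B ⟹ A* ⊆ B*`). [cite: AlonBoppana1987, §3.1] -/
theorem closure_mono {r l : ℕ} {A B : Finset (Finset α)} (hAB : A ⊆ B) :
    closure r l A ⊆ closure r l B := by
  by_cases hB : B ⊆ smallSets α l
  · exact closure_subset_of_isClosedFamily (hAB.trans (subset_closure hB))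
      (isClosedFamily_closure r l B)
  · rw [closure_eq_smallSets_of_not_subset hB]
    exact closure_subset_smallSets r l A

/-- Sandwiched families have the same closure: `A ⊆ B ⊆ A* ⟹ B* = A*`. [folklore] -/
theorem closure_eq_of_subset_of_subset_closure {r l : ℕ} {A B : Finset (Finset α)} (hAB : A ⊆ B)
    (hBA : B ⊆ closure r l A) : closure r l B = closure r l A :=
  Subset.antisymm (closure_subset_of_isClosedFamily hBA (isClosedFamily_closure r l A))
    (closure_mono hAB)

/-! ### Minimal members of closed families (Alon–Boppana 1987, Corollary 3.3) -/

/-- The minimal members of cardinality `≤ k` of a closed family have property `P(r, k)`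
(Alon–Boppana 1987, proof of Corollary 3.3: an implied proper subset `U` of a minimal member
`W` would lie in the family, contradicting minimality; if `|U| ≤ 1` then `∅` lies in the
family and minimality forces `W = ∅`, which has no proper subset). [cite: AlonBoppana1987, Cor. 3.3] -/
theorem IsClosedFamily.hasPropP_minimals {r l : ℕ} {A : Finset (Finset α)} (hA : IsClosedFamily r l A)
    (k : ℕ) : HasPropP r k ((minimals A).filter fun W => #W ≤ k) := by
  refine ⟨fun W hW => (mem_filter.1 hW).2, fun W hW U hU hI => ?_⟩
  have hWmin := mem_minimals.1 (mem_filter.1 hW).1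
  have hWl : #W ≤ l := (mem_smallSets.1 (hA.subset hWmin.1)).1
  have hUl : #U ≤ l := (card_lt_card hU).le.trans hWl
  have hcan := hA.mem_of_implies U hUl
    (hI.mono ((filter_subset _ _).trans (minimals_subset A)))
  by_cases h1 : #U ≤ 1
  · rw [canon_eq_empty h1] at hcan
    have hW0 : W = ∅ := (hWmin.2 ∅ hcan (empty_subset W)).symm
    rw [hW0] at hU
    exact (not_ssubset_empty U) hU
  · rw [canon_eq_self (by omega)] at hcan
    exact hU.2 (hWmin.2 U hcan hU.1).symm.subset

/-- **Alon–Boppana, Corollary 3.3**: a closed family (`r ≥ 2`) has at most `(r - 1) ^ k` minimal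
members of cardinality at most `k` (for every `k`; the printed `k ≥ 1` is not needed).
[cite: AlonBoppana1987, Cor. 3.3] -/
theorem IsClosedFamily.card_minimals_filter_le {r l : ℕ} {A : Finset (Finset α)}
    (hA : IsClosedFamily r l A) (hr : 2 ≤ r) (k : ℕ) :
    #((minimals A).filter fun W => #W ≤ k) ≤ (r - 1) ^ k :=
  (hA.hasPropP_minimals k).card_le hr

/-- In particular a closed family (`r ≥ 2`) in `𝒱(l)` has at most `(r - 1) ^ l` minimal
members. [cite: AlonBoppana1987, Cor. 3.3] -/
theorem IsClosedFamily.card_minimals_le {r l : ℕ} {A : Finset (Finset α)}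
    (hA : IsClosedFamily r l A) (hr : 2 ≤ r) : #(minimals A) ≤ (r - 1) ^ l := by
  have h : (minimals A).filter (fun W => #W ≤ l) = minimals A :=
    filter_true_of_mem fun W hW => (mem_smallSets.1 (hA.subset (minimals_subset A hW))).1
  rw [← h]
  exact hA.card_minimals_filter_le hr l

/-! ### The size of the universe -/

/-- `Σ_{k ≤ l} n^k ≤ (n + 1)^l`. [folklore] -/
theorem sum_range_pow_le_succ_pow (n l : ℕ) : ∑ k ∈ range (l + 1), n ^ k ≤ (n + 1) ^ l := by
  rw [add_pow]
  refine sum_le_sum fun k hk => ?_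
  rw [one_pow, mul_one]
  exact Nat.le_mul_of_pos_right _ (Nat.choose_pos (Nat.lt_succ_iff.1 (mem_range.1 hk)))

/-- `|𝒱(l)| ≤ (|V| + 1) ^ l`: there are at most `Σ_{k ≤ l} (|V| choose k) ≤ Σ_{k ≤ l} |V|^k`
vertex sets of cardinality `≤ l` (the crude bound on the number of closure steps, Alon–Boppana
1987, §3.2, before Lemma 3.4: `|𝒱(l)| = Σ_{k ≤ l} (m choose k) ≤ m^l`). [cite: AlonBoppana1987, §3.2] -/
theorem card_smallSets_le (l : ℕ) : #(smallSets α l) ≤ (Fintype.card α + 1) ^ l := by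
  classical
  calc #(smallSets α l) ≤ #((range (l + 1)).biUnion fun k => powersetCard k (univ : Finset α)) := by
        refine card_le_card fun W hW => ?_
        rw [mem_smallSets] at hW
        exact mem_biUnion.2 ⟨#W, mem_range.2 (Nat.lt_succ_of_le hW.1),
          mem_powersetCard.2 ⟨subset_univ _, rfl⟩⟩
    _ ≤ ∑ k ∈ range (l + 1), #(powersetCard k (univ : Finset α)) := card_biUnion_le
    _ = ∑ k ∈ range (l + 1), (Fintype.card α).choose k := by
        simp only [card_powersetCard, card_univ]
    _ ≤ ∑ k ∈ range (l + 1), (Fintype.card α) ^ k :=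
        sum_le_sum fun k _ => Nat.choose_le_pow _ _
    _ ≤ (Fintype.card α + 1) ^ l := sum_range_pow_le_succ_pow _ _

end Razborov

end Literature.Computability.Complexity
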